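import Summits.RiemannHypothesis.RiemannHypothesis.Theorems.LiDirichletEchoLiWindowContourChar
import HarnessLib

/-!
# RiemannHypothesis / LiDirichletEcho — complex companion, part 1: Bombieri's rectangle in the ANTISYMMETRIC channel
# (the imaginary part of the upper window trace of `L(s, χ)`; RH-FREE, GRH-FREE)

RH-FREE · GRH-FREE [rh-li-eng g5].  Route `Theses/LiDirichletEcho.lean` is CLOSED·proved (leaf `LiTheory.LiZeroWindowEchoDirichlet`,
the REAL channel); this file starts the proof of the theory seat's typed COMPLEX companion `LiTheory.LiZeroWindowEchoDirichletComplex`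
(`Theorems/LiEchoDirichletDefs.lean`; the cell's data row DATA.md §P found the imaginary channel `Im W = +Im χ(2)·E₂`).  The same
weighted argument principle on `[−1/2, 3/2] × [T₁, T₂]` for `F_n · ξ'/ξ(·, χ)` with the left edge folded by
`ξ'/ξ(1 − w̄, χ) = −conj ξ'/ξ(w, χ)`, read in REAL parts instead of imaginary parts, gives for the COMPLEX upper window sum
`U = Σ_{T₁ < Im ρ < T₂} m_ρ (1 − 1/ρ)ⁿ` at good heights `1 ≤ T₁ < T₂`:

  `2 Im U = charRightEdgeIm χ n T₁ T₂ + charHorizRe χ n T₂ − charHorizRe χ n T₁`,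

where the right edge now carries the ANTISYMMETRISED weight `k⁻_n(w) = F_n(w) − F_n(1 − w)` (`liAntiWeight`) and the horizontal
edges enter through the REAL parts of the same integrals; and on `Re w = 3/2` the right edge splits into its gamma and prime pieces
exactly as in K1χ (`WindowContourChar.logDeriv_dirichletXi_rightPt`).  Nothing here bears on the truth of RH or GRH.
-/

noncomputable section

-- D-0017: `Summit.<S>.<S>.…` is the designed namespace of a single-problem summit.
set_option linter.dupNamespace false

open Complex MeasureTheory intervalIntegral Set
open scoped Real Interval ComplexConjugate ArithmeticFunction.vonMangoldt

namespace Summit.RiemannHypothesis.RiemannHypothesis.Theorems.LiTheory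

open Literature.NumberTheory.LFunctions Literature.NumberTheory.LFunctions.DirichletTheta
  Literature.NumberTheory.LFunctions.ExplicitPsiChar

/-! ### Vocabulary of the antisymmetric channel -/

/-- The ANTISYMMETRISED weight `k⁻_n(w) = F_n(w) − F_n(1 − w)` (`= 2i sin(nθ(t))` on `Re w = ½`). -/
def liAntiWeight (n : ℕ) (w : ℂ) : ℂ := liWeight n w - liWeight n (1 - w)

variable {q : ℕ} [NeZero q]

/-- The COMPLEX upper zero trace `Σ_{ρ ∈ lfunctionZeroBox χ T, Im ρ > 0} m_ρ (1 − 1/ρ)ⁿ` (its real part is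
`charUpperZeroTrace`). -/
def charUpperZeroTraceC (χ : DirichletCharacter ℂ q) (n : ℕ) (T : ℝ) : ℂ :=
  ∑ᶠ ρ ∈ lfunctionZeroBox χ T ∩ {ρ : ℂ | 0 < ρ.im}, (DirichletDisc.zeroOrder χ ρ : ℂ) * (1 - 1 / ρ) ^ n

/-- The COMPLEX windowed upper trace `Σ_{T₁ < Im ρ ≤ T₂} m_ρ (1 − 1/ρ)ⁿ`. -/
def charUpperTraceWindowC (χ : DirichletCharacter ℂ q) (n : ℕ) (T₁ T₂ : ℝ) : ℂ :=
  charUpperZeroTraceC χ n T₂ - charUpperZeroTraceC χ n T₁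

/-- `Re` of the complex windowed upper trace is the windowed upper trace. -/
theorem charUpperTraceWindowC_re (χ : DirichletCharacter ℂ q) (n : ℕ) (T₁ T₂ : ℝ) :
    (charUpperTraceWindowC χ n T₁ T₂).re = charUpperTraceWindow χ n T₁ T₂ := by
  simp [charUpperTraceWindowC, charUpperZeroTraceC, charUpperTraceWindow, charUpperZeroTrace, Complex.sub_re]

/-- `(1/π) Im ∫_{T₁}^{T₂} ξ'/ξ(3/2 + iy, χ) k⁻_n(3/2 + iy) dy` — the right edge of the antisymmetric channel. -/
def charRightEdgeIm (χ : DirichletCharacter ℂ q) (n : ℕ) (T₁ T₂ : ℝ) : ℝ :=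
  1 / Real.pi * (∫ y in T₁..T₂, logDeriv (dirichletXi χ) (liRightPt y) * liAntiWeight n (liRightPt y)).im

/-- `(1/π) Re ∫_{−1/2}^{3/2} ξ'/ξ(x + iT, χ) F_n(x + iT) dx` — the REAL part of a horizontal edge integral. -/
def charHorizRe (χ : DirichletCharacter ℂ q) (n : ℕ) (T : ℝ) : ℝ :=
  1 / Real.pi *
    (∫ x in (-(1 / 2 : ℝ))..(3 / 2 : ℝ), logDeriv (dirichletXi χ) (x + T * Complex.I) * liWeight n (x + T * Complex.I)).re

/-- GAMMA piece of the antisymmetric right edge: `(1/π) Im ∫ (½ log(q/π) + ½ ψ((w + a)/2)) k⁻_n(w) dy`. -/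
def charGammaEdgeIm (χ : DirichletCharacter ℂ q) (n : ℕ) (T₁ T₂ : ℝ) : ℝ :=
  1 / Real.pi *
    (∫ y in T₁..T₂, ((Real.log (q / Real.pi) : ℂ) / 2
        + 1 / 2 * Complex.digamma ((liRightPt y + (charParity χ : ℂ)) / 2)) * liAntiWeight n (liRightPt y)).im

/-- PRIME piece of the antisymmetric right edge: `(1/π) Im ∫ L(χΛ, w) k⁻_n(w) dy`. -/
def charPrimeEdgeIm (χ : DirichletCharacter ℂ q) (n : ℕ) (T₁ T₂ : ℝ) : ℝ :=
  1 / Real.pi *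
    (∫ y in T₁..T₂, LSeries (fun m : ℕ ↦ χ (m : ZMod q) * (Λ m : ℂ)) (liRightPt y) * liAntiWeight n (liRightPt y)).im

namespace ImContourChar

open WindowContour WindowContourChar

variable {χ : DirichletCharacter ℂ q}

/-- At a good height `T₂` and `0 ≤ T₁ ≤ T₂`, the complex windowed UPPER trace is the window's Li sum
`Σᶠ_{T₁ < Im ρ < T₂} m(ρ)(1 − 1/ρ)ⁿ`. -/
theorem charUpperTraceWindowC_eq (hχ : χ.IsPrimitive) (h1 : χ ≠ 1) (n : ℕ) {T₁ T₂ : ℝ} (hT₁ : 0 ≤ T₁)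
    (hT : T₁ ≤ T₂) (hgood : T₂ ∈ charGoodHeights χ) :
    charUpperTraceWindowC χ n T₁ T₂ =
      ∑ᶠ ρ ∈ {ρ : ℂ | ρ ∈ charNontrivialZeros χ ∧ T₁ < ρ.im ∧ ρ.im < T₂},
        (DirichletDisc.zeroOrder χ ρ : ℂ) * (1 - 1 / ρ) ^ n := by
  -- as `WindowContourChar.charUpperTraceWindow_eq_re`, without taking real parts
  have hne := im_ne_of_goodHeight hχ h1 hgood
  set S₁ : Set ℂ := lfunctionZeroBox χ T₁ ∩ {ρ : ℂ | 0 < ρ.im} with hS₁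
  set W : Set ℂ := {ρ : ℂ | ρ ∈ charNontrivialZeros χ ∧ T₁ < ρ.im ∧ ρ.im < T₂} with hW
  have hS₁f : S₁.Finite := (lfunctionZeroBox_finite h1 T₁).subset inter_subset_left
  have hWf : W.Finite := window_finite h1 T₁ T₂
  have hunion : lfunctionZeroBox χ T₂ ∩ {ρ : ℂ | 0 < ρ.im} = S₁ ∪ W := by
    ext ρ
    simp only [hS₁, hW, mem_inter_iff, mem_union, mem_setOf_eq, mem_lfunctionZeroBox, mem_charNontrivialZeros]
    constructor
    · rintro ⟨⟨hL, h0, h1', habs⟩, him⟩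
      by_cases hle : ρ.im ≤ T₁
      · exact Or.inl ⟨⟨hL, h0, h1', abs_le.2 ⟨by linarith, hle⟩⟩, him⟩
      · refine Or.inr ⟨⟨hL, h0, h1'⟩, lt_of_not_ge hle, lt_of_le_of_ne (abs_le.1 habs).2 ?_⟩
        exact hne ρ (mem_charNontrivialZeros.2 ⟨hL, h0, h1'⟩)
    · rintro (⟨⟨hL, h0, h1', habs⟩, him⟩ | ⟨⟨hL, h0, h1'⟩, h3, h4⟩)
      · exact ⟨⟨hL, h0, h1', (abs_le.2 ⟨by linarith [(abs_le.1 habs).1], by linarith [(abs_le.1 habs).2]⟩)⟩, him⟩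
      · exact ⟨⟨hL, h0, h1', abs_le.2 ⟨by linarith, h4.le⟩⟩, by
          show 0 < ρ.im
          linarith⟩
  have hdisj : Disjoint S₁ W := by
    rw [Set.disjoint_left]
    rintro ρ ⟨hρ, -⟩ ⟨-, h3, -⟩
    have := (abs_le.1 (mem_lfunctionZeroBox.1 hρ).2.2.2).2
    linarith
  unfold charUpperTraceWindowC charUpperZeroTraceC
  rw [hunion, finsum_mem_union hdisj hS₁f hWf]
  ring

/-- **The contour identity in the ANTISYMMETRIC channel.**  For primitive `χ ≠ 1` and good heights `1 ≤ T₁ < T₂`: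
`2 · Im (charUpperTraceWindowC χ n T₁ T₂) = charRightEdgeIm χ n T₁ T₂ + charHorizRe χ n T₂ − charHorizRe χ n T₁`. -/
theorem im_window_contour (hχ : χ.IsPrimitive) (h1 : χ ≠ 1) (n : ℕ) {T₁ T₂ : ℝ} (hT1 : 1 ≤ T₁) (hlt : T₁ < T₂)
    (hg1 : T₁ ∈ charGoodHeights χ) (hg2 : T₂ ∈ charGoodHeights χ) :
    2 * (charUpperTraceWindowC χ n T₁ T₂).im =
      charRightEdgeIm χ n T₁ T₂ + charHorizRe χ n T₂ - charHorizRe χ n T₁ := by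
  -- the REAL parts of `WindowContourChar.window_contour`'s boundary identity
  have hT₁ : 0 < T₁ := by linarith
  have hπ := Real.pi_pos
  have key := Literature.Analysis.Complex.integral_boundary_rect_logDeriv_mul (f := dirichletXi χ) (g := liWeight n)
    (a := -(1 / 2)) (b := 3 / 2) (c := T₁) (d := T₂) (by norm_num) hlt
    (fun z _ ↦ (differentiable_dirichletXi h1).analyticAt z)
    (fun z hz ↦ analyticAt_liWeight n (by
      intro h0
      have hz2 := (Complex.mem_reProdIm.1 hz).2
      rw [h0, Complex.zero_im] at hz2
      linarith [hz2.1]))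
    (fun x hx ↦ hg1 x hx) (fun x hx ↦ hg2 x hx)
    (fun y _ ↦ dirichletXi_ne_zero_of_not_mem_strip hχ h1 (Or.inl (by simp)))
    (fun y _ ↦ dirichletXi_ne_zero_of_not_mem_strip hχ h1 (Or.inr (by simp; norm_num)))
  simp only [← logDeriv_apply] at key
  rw [residueSum_eq hχ h1 n T₁ T₂] at key
  set Z : ℂ := ∑ᶠ ρ ∈ {ρ : ℂ | ρ ∈ charNontrivialZeros χ ∧ T₁ < ρ.im ∧ ρ.im < T₂},
    (DirichletDisc.zeroOrder χ ρ : ℂ) * (1 - 1 / ρ) ^ n with hZ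
  set Ibot := ∫ x : ℝ in (-(1 / 2) : ℝ)..(3 / 2), logDeriv (dirichletXi χ) (x + T₁ * I) * liWeight n (x + T₁ * I)
    with hIbot
  set Itop := ∫ x : ℝ in (-(1 / 2) : ℝ)..(3 / 2), logDeriv (dirichletXi χ) (x + T₂ * I) * liWeight n (x + T₂ * I)
    with hItop
  set IR := ∫ y : ℝ in T₁..T₂, logDeriv (dirichletXi χ) (((3 / 2 : ℝ) : ℂ) + y * I) *
    liWeight n (((3 / 2 : ℝ) : ℂ) + y * I) with hIR
  set IR' := ∫ y : ℝ in T₁..T₂, logDeriv (dirichletXi χ) (((3 / 2 : ℝ) : ℂ) + y * I) *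
    liWeight n (1 - (((3 / 2 : ℝ) : ℂ) + y * I)) with hIR'
  set IL := ∫ y : ℝ in T₁..T₂, logDeriv (dirichletXi χ) (((-(1 / 2) : ℝ) : ℂ) + y * I) *
    liWeight n (((-(1 / 2) : ℝ) : ℂ) + y * I) with hIL
  -- fold the left edge (verbatim from `WindowContourChar.window_contour`)
  have hfold : IL = -conj IR' := by
    have e : ∀ y : ℝ, logDeriv (dirichletXi χ) (((-(1 / 2) : ℝ) : ℂ) + y * I) *
        liWeight n (((-(1 / 2) : ℝ) : ℂ) + y * I) =
        -conj (logDeriv (dirichletXi χ) (((3 / 2 : ℝ) : ℂ) + y * I) *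
          liWeight n (1 - (((3 / 2 : ℝ) : ℂ) + y * I))) := by
      intro y
      have h1' : (((-(1 / 2) : ℝ) : ℂ) + y * I) = 1 - conj (((3 / 2 : ℝ) : ℂ) + y * I) := by
        apply Complex.ext
        · simp only [Complex.add_re, Complex.ofReal_re, Complex.mul_re, Complex.I_re, Complex.ofReal_im,
            Complex.I_im, Complex.sub_re, Complex.one_re, Complex.conj_re]
          norm_num
        · simp only [Complex.add_im, Complex.ofReal_re, Complex.mul_im, Complex.I_re, Complex.ofReal_im,
            Complex.I_im, Complex.sub_im, Complex.one_im, Complex.conj_im]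
          norm_num
      have h2 : (((-(1 / 2) : ℝ) : ℂ) + y * I) = conj (1 - (((3 / 2 : ℝ) : ℂ) + y * I)) := by
        rw [h1', map_sub, map_one]
      have hxi : logDeriv (dirichletXi χ) (1 - conj (((3 / 2 : ℝ) : ℂ) + y * I)) =
          -conj (logDeriv (dirichletXi χ) (((3 / 2 : ℝ) : ℂ) + y * I)) := by
        rw [logDeriv_apply, logDeriv_apply]
        exact logDeriv_dirichletXi_one_sub_conj hχ h1 _
      conv_lhs => rw [h1']
      rw [hxi, ← h1', h2, liWeight_conj, map_mul]
      ring
    rw [hIL, intervalIntegral.integral_congr (fun y _ ↦ e y), intervalIntegral.integral_neg,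
      intervalIntegral.integral_of_le hlt.le, integral_conj, ← intervalIntegral.integral_of_le hlt.le]
  -- imaginary part of `Z` = real parts of the boundary
  have hZ' : charUpperTraceWindowC χ n T₁ T₂ = Z := charUpperTraceWindowC_eq hχ h1 n hT₁.le hlt.le hg2
  have h2Zim : 2 * Z.im = 1 / Real.pi * (Itop.re - Ibot.re + IR.im - IL.im) := by
    have hRe := congrArg Complex.re key
    simp only [Complex.sub_re, Complex.add_re, Complex.mul_re, Complex.I_re, Complex.I_im, Complex.mul_im,
      Complex.ofReal_re, Complex.ofReal_im, Complex.re_ofNat, Complex.im_ofNat, zero_mul, one_mul, mul_zero,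
      mul_one, add_zero, sub_zero, zero_sub] at hRe
    field_simp
    linarith
  have hILim : IL.im = IR'.im := by rw [hfold, Complex.neg_im, Complex.conj_im, neg_neg]
  -- the antisymmetric right edge is `IR − IR'`
  have hc : Continuous fun y : ℝ ↦ logDeriv (dirichletXi χ) (((3 / 2 : ℝ) : ℂ) + y * I) :=
    continuous_logDeriv_dirichletXi_rightEdge hχ h1
  have hw0 : ∀ y : ℝ, (((3 / 2 : ℝ) : ℂ) + y * I) ≠ 0 := fun y h ↦ by
    have := congrArg Complex.re h; norm_num at this
  have hw1 : ∀ y : ℝ, 1 - (((3 / 2 : ℝ) : ℂ) + y * I) ≠ 0 := fun y h ↦ by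
    have := congrArg Complex.re h; norm_num at this
  have hcw : Continuous fun y : ℝ ↦ (((3 / 2 : ℝ) : ℂ) + y * I) := by fun_prop
  have hcw' : Continuous fun y : ℝ ↦ 1 - (((3 / 2 : ℝ) : ℂ) + y * I) := by fun_prop
  have hcF : Continuous fun y : ℝ ↦ liWeight n (((3 / 2 : ℝ) : ℂ) + y * I) := by
    refine continuous_iff_continuousAt.2 fun y ↦ ?_
    show ContinuousAt ((liWeight n) ∘ fun y : ℝ ↦ (((3 / 2 : ℝ) : ℂ) + y * I)) y
    exact ContinuousAt.comp (analyticAt_liWeight n (hw0 y)).continuousAt hcw.continuousAt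
  have hcF' : Continuous fun y : ℝ ↦ liWeight n (1 - (((3 / 2 : ℝ) : ℂ) + y * I)) := by
    refine continuous_iff_continuousAt.2 fun y ↦ ?_
    show ContinuousAt ((liWeight n) ∘ fun y : ℝ ↦ 1 - (((3 / 2 : ℝ) : ℂ) + y * I)) y
    exact ContinuousAt.comp (analyticAt_liWeight n (hw1 y)).continuousAt hcw'.continuousAt
  have i1 : IntervalIntegrable (fun y : ℝ ↦ logDeriv (dirichletXi χ) (((3 / 2 : ℝ) : ℂ) + y * I) *
      liWeight n (((3 / 2 : ℝ) : ℂ) + y * I)) volume T₁ T₂ := (hc.mul hcF).intervalIntegrable _ _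
  have i2 : IntervalIntegrable (fun y : ℝ ↦ logDeriv (dirichletXi χ) (((3 / 2 : ℝ) : ℂ) + y * I) *
      liWeight n (1 - (((3 / 2 : ℝ) : ℂ) + y * I))) volume T₁ T₂ := (hc.mul hcF').intervalIntegrable _ _
  have hright : charRightEdgeIm χ n T₁ T₂ = 1 / Real.pi * (IR - IR').im := by
    unfold charRightEdgeIm
    rw [hIR, hIR', ← intervalIntegral.integral_sub i1 i2]
    congr 2
    refine intervalIntegral.integral_congr fun y _ ↦ ?_
    rw [liRightPt_eq, liAntiWeight]
    ring
  have hbot : charHorizRe χ n T₁ = 1 / Real.pi * Ibot.re := rfl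
  have htop : charHorizRe χ n T₂ = 1 / Real.pi * Itop.re := rfl
  rw [hZ', h2Zim, hright, hbot, htop, hILim, Complex.sub_im]
  ring

/-- **Splitting the antisymmetric right edge.**  For primitive `χ ≠ 1` and any `T₁, T₂`:
`charRightEdgeIm χ = charGammaEdgeIm χ − charPrimeEdgeIm χ`. -/
theorem rightEdgeIm_split (hχ : χ.IsPrimitive) (h1 : χ ≠ 1) (n : ℕ) (T₁ T₂ : ℝ) :
    charRightEdgeIm χ n T₁ T₂ = charGammaEdgeIm χ n T₁ T₂ - charPrimeEdgeIm χ n T₁ T₂ := by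
  -- as `WindowContourChar.rightEdge_split` with `liAntiWeight` in place of `liSymWeight`
  have hw : ∀ y : ℝ, (liRightPt y).re = 3 / 2 := fun y ↦ by simp [liRightPt]
  have hw0 : ∀ y : ℝ, liRightPt y ≠ 0 := fun y h ↦ by have := hw y; rw [h] at this; norm_num at this
  have hw1 : ∀ y : ℝ, liRightPt y - 1 ≠ 0 := fun y h ↦ by
    have := congrArg Complex.re h; simp [liRightPt] at this; norm_num at this
  have hw1' : ∀ y : ℝ, 1 - liRightPt y ≠ 0 := fun y h ↦ hw1 y (by rw [← neg_sub, h, neg_zero])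
  have hcw : Continuous liRightPt := by unfold liRightPt; fun_prop
  have hcw' : Continuous fun y : ℝ ↦ 1 - liRightPt y := continuous_const.sub hcw
  have hck : Continuous fun y : ℝ ↦ liAntiWeight n (liRightPt y) := by
    refine continuous_iff_continuousAt.2 fun y ↦ ?_
    have h1 : ContinuousAt ((liWeight n) ∘ liRightPt) y :=
      ContinuousAt.comp (analyticAt_liWeight n (hw0 y)).continuousAt hcw.continuousAt
    have h2 : ContinuousAt ((liWeight n) ∘ fun y : ℝ ↦ 1 - liRightPt y) y :=
      ContinuousAt.comp (analyticAt_liWeight n (hw1' y)).continuousAt hcw'.continuousAt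
    exact h1.sub h2
  have hcxi : Continuous fun y : ℝ ↦ logDeriv (dirichletXi χ) (liRightPt y) := by
    have := continuous_logDeriv_dirichletXi_rightEdge hχ h1
    refine this.congr fun y ↦ ?_
    rw [liRightPt_eq]
  have hcgam : Continuous fun y : ℝ ↦ ((Real.log (q / Real.pi) : ℂ) / 2
      + 1 / 2 * Complex.digamma ((liRightPt y + (charParity χ : ℂ)) / 2)) := by
    refine continuous_iff_continuousAt.2 fun y ↦ ?_
    have hψ : ContinuousAt (fun y : ℝ ↦ Complex.digamma ((liRightPt y + (charParity χ : ℂ)) / 2)) y := by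
      refine (continuousAt_digamma_of_re_pos ?_).comp ((hcw.continuousAt.add continuousAt_const).div_const 2)
      rw [Complex.div_ofNat_re, Complex.add_re, hw y, Complex.natCast_re]
      have h0 : (0 : ℝ) ≤ charParity χ := Nat.cast_nonneg _
      linarith
    exact continuousAt_const.add (continuousAt_const.mul hψ)
  set B : ℝ → ℂ := fun y ↦ ((Real.log (q / Real.pi) : ℂ) / 2
      + 1 / 2 * Complex.digamma ((liRightPt y + (charParity χ : ℂ)) / 2)) * liAntiWeight n (liRightPt y) with hB
  set X : ℝ → ℂ := fun y ↦ logDeriv (dirichletXi χ) (liRightPt y) * liAntiWeight n (liRightPt y) with hX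
  set C : ℝ → ℂ := fun y ↦ LSeries (fun m : ℕ ↦ χ (m : ZMod q) * (Λ m : ℂ)) (liRightPt y) *
    liAntiWeight n (liRightPt y) with hC
  have iB : IntervalIntegrable B volume T₁ T₂ := (hcgam.mul hck).intervalIntegrable _ _
  have iX : IntervalIntegrable X volume T₁ T₂ := (hcxi.mul hck).intervalIntegrable _ _
  have hsplit : ∀ y : ℝ, X y = B y - C y := by
    intro y
    simp only [hX, hB, hC]
    rw [logDeriv_dirichletXi_rightPt h1 y]
    ring
  have iC : IntervalIntegrable C volume T₁ T₂ := by
    refine (iB.sub iX).congr fun y _ ↦ ?_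
    show B y - X y = C y
    rw [hsplit y]
    ring
  have hint : ∫ y in T₁..T₂, X y = (∫ y in T₁..T₂, B y) - ∫ y in T₁..T₂, C y := by
    rw [← intervalIntegral.integral_sub iB iC]
    exact intervalIntegral.integral_congr fun y _ ↦ hsplit y
  unfold charRightEdgeIm charGammaEdgeIm charPrimeEdgeIm
  change 1 / Real.pi * (∫ y in T₁..T₂, X y).im =
    1 / Real.pi * (∫ y in T₁..T₂, B y).im - 1 / Real.pi * (∫ y in T₁..T₂, C y).im
  rw [hint, Complex.sub_im]
  ring

end ImContourChar

end Summit.RiemannHypothesis.RiemannHypothesis.Theorems.LiTheory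

end
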